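import Summits.BirchSwinnertonDyer.BirchSwinnertonDyer.Theorems.QuadraticBranchSignedControlPlusEtaNonsurjThetaFunctionalEquationNormCoordinateMinimalShape
import Summits.BirchSwinnertonDyer.BirchSwinnertonDyer.Theorems.QuadraticBranchSignedControlPlusEtaNonsurjCorpuzLeiTransferOPEN
import Summits.BirchSwinnertonDyer.Rank1Residual.X1.LambdaSqueezeAlgebra
import Summits.BirchSwinnertonDyer.Rank1Residual.X1.MuPart
import Summits.BirchSwinnertonDyer.Rank1Residual.X11a.MuLambdaSplit
import Literature.NumberTheory.EllipticCurves.HatleyLei2019.SignedSelmerEtaCongruentLambdaInvariant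
import HarnessLib

/-!
# Route `QuadraticBranchSignedControl` (rung K8, cell `bsd-potss`), residual crux `PlusEtaMainConjectureNonsurj`
# (stmt-BirchSwinnertonDyer-19606): Part XLV — THE `λ`-TRANSFER ROAD (Greenberg–Vatsal's squeeze at `η`):
# **(C1⁺_η) at a row `V` from a congruent row `V″` where `μ(X⁺(V″/K_∞)^η) = 0` and `λ` is known, Hatley–Lei's
# `μ`/`λ`-transfer (PUBLISHED, Literature named fact), Kobayashi's Thm. 4.1 at `η`, and the analytic `(μ, λ)` of
# `L_p⁺(V, η, X)` — NO preprint binder** (seat `bsd-potss-k8eta-c2` g33; kernel; CONDITIONAL on the displayed named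
# facts in hypothesis position)

WHY. Skeleton v7 of crux 19606 settles every in-table NON-CM row through the OPEN binder
`CorpuzLei2025_etaPlusMainConjecture_transfer_anMu_OPEN` (Corpuz–Lei 2025 Thms 5.3 + 5.9 + 5.10 composed: the `η`-main conjecture
TRANSFERS along `V[p] ≅ V″[p]` from a CM row). The composite has a kernel-checkable core: Greenberg–Vatsal's squeeze. If `g`
generates `Char X⁺(V/K_∞)^η`, Kobayashi's Thm. 4.1 at `η` gives `g ∣ pⁿ·L_p⁺(V,η,X)`; if moreover `μ(g) = μ(Lη) = 0` and
`λ(g) = λ(Lη)`, then `(g) = (Lη)` (§131, pure `Λ`-algebra). The two equalities of invariants are TRANSFERRED from `V″`: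
`μ(g) = 0` and `λ(g) + Σ_{ℓ∈Σ₀} δ_ℓ(W) = λ″ + Σ_{ℓ∈Σ₀} δ_ℓ(W″)` by Hatley–Lei 2019 Thm. 4.6 (both claims) + Prop. 5.1 / Cor. 5.2
(Literature named fact `HatleyLei2019.thm46_prop51_etaSignedMuLambda_transfer_of_torsionIso`, this seat, p775095; local terms
= the tree's `GreenbergVatsal2000.delta` of the `η`-TWISTS `W = V^{(p*)}`, `W″`), and `μ(Lη) = 0`, `λ(Lη) + Σ δ(W) = λ″ + Σ δ(W″)` on
the ANALYTIC side — per row a NUMERICAL certificate (the cell's censuses P-32N / P-32F give `λ⁺`; this seat's table P-33T checks the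
identity on 26/26 in-table congruent pairs), class-wide Corpuz–Lei's Thm. 5.3 (Literature named fact
`CorpuzLei2025.thm53_etaPlusAnalyticMuLambda_transfer_of_torsionIso`, this seat). So on a row the preprint composite is replaced by:
HL19 (published) + Kob 2.2η/4.1η + the anchor's `(μ, λ)_alg` + two displayed numbers.

MATHEMATICS. §131 `span_eq_of_dvd_C_pow_mul_of_mu_eq_zero_of_lam_eq`: `g ∣ C(pⁿ)·L`, `μ(g) = μ(L) = 0`, `λ(g) = λ(L)` ⟹ `(g) = (L)`
(write `C(pⁿ)L = g·h`; `μ`, `λ` are additive, so `μ(h) = n`, `λ(h) = 0`, i.e. `h = C(pⁿ)·unit` by Weierstrass; cancel `C(pⁿ)`).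
§132 `etaCharIdeal_eq_span_of_lambdaTransfer`: at a datum `D` of `V` in Kobayashi's frame: HL19 (with (irred) by Serre, (tor) by Thm. 2.2η)
from ANY anchor datum (exists: `Kobayashi2003.nonempty_etaSignedSelmerDualData_cyclotomic`) whose `(μ, λ) = (0, λ″)` is displayed,
`μ(g) = μ(D.X)` / `λ(g) = λ(D.X)` (tree: `MuPart.mu_generator_eq_muInvariant`, `ParitySqueeze.lam_generator_eq_lambdaInvariant`), Thm. 4.1η, §131.
§133 `quadraticBranchPlusEtaMainConjectureAt_of_lambdaTransfer`: the node (C1⁺_η)(V) from the same inputs quantified over frames.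
§134 `anchor_mu_lambda_of_plusEtaMainConjectureAt`: the anchor's displayed `(μ, λ)_alg = (0, λ(Lη″))` FROM (C1⁺_η)(V″) + `μ_an(V″) = 0`
(how a CM anchor settled by k8q-c2 g3/g4 / k8eta-c2 g7 feeds §133).

HONEST FRAMING (cell `bsd-potss`; FULL-BSD rank ≤ 1 programme, HUMAN RULING D-0036/D-0074): TOOL THEOREMS ONLY — no definition, no
named fact minted here, no `sorry`, axioms standard; CONDITIONAL on the named Literature facts in hypothesis position (Hatley–Lei 2019
Thm. 4.6 + Prop. 5.1 = `h46`; Kobayashi 2003 Thm. 2.2η = `h22`, Thm. 4.1η = `h41`) and on the DISPLAYED per-row inputs (the congruence,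
the anchor's `(μ, λ)`, the analytic `μ = 0` and `λ`, the local sums). No stub of 19606 is proved by name; the binder
`stub_etaMC_transferCL25` is NOT discharged here (its class-wide discharge needs the analytic fact + existence glue — sequel); the
crux and the route stay OPEN; nothing is booked; `BSD(W, p)` is claimed for no pair. `--supports stmt-BirchSwinnertonDyer-19606`.

References: [HatleyLei2019] Thm. 4.6, Cor. 2.10, Prop. 5.1, Cor. 5.2; [GreenbergVatsal2000] p. 4 (the squeeze), §2 Prop. (2.4);
[Kobayashi2003] Thm. 2.2 (p. 5), §4 + Thm. 4.1 (p. 8); [CorpuzLei2025] Thms 5.3 / 5.9 / 5.10 (the composite this road replaces on a row);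
[Washington1997] §7.1, §13.2. Tree: Parts XXII (`exists_weierstrass_of_ne_zero`), XXXIII (`natCast_pow_mul_mem_span_singleton_iff`),
`X1.MuLambdaAlgebra`, `X1.MuPart`, `X1.LambdaSqueezeAlgebra`, `X11a.MuLambdaSplit`, HL19 μ-file §2 pattern.
-/

set_option autoImplicit false
set_option linter.dupNamespace false
noncomputable section

open scoped Classical

open NumberField IsDedekindDomain CongruenceSubgroup Field WeierstrassCurve
open Literature.NumberTheory.EllipticCurves
open Literature.NumberTheory.EllipticCurves.ModularForms
open Literature.NumberTheory.GaloisRepresentations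
open Literature.NumberTheory.EllipticCurves.IwasawaAlgebra
open Literature.NumberTheory.EllipticCurves.GreenbergVatsal2000
open ZpExtension
open Summit.BirchSwinnertonDyer.Rank1Residual.Additive
open Summit.BirchSwinnertonDyer.Rank1Residual.X1.MuLambda
open Summit.BirchSwinnertonDyer.Rank1Residual.X1.ParitySqueeze (lam_generator_eq_lambdaInvariant lam_C_pow_mul)
open Summit.BirchSwinnertonDyer.Rank1Residual.X1.MuPart (mu_generator_eq_muInvariant)
open Summit.BirchSwinnertonDyer.Rank1Residual.X11a (mu_eq_zero_of_hasUnitContent hasUnitContent_of_mu_eq_zero)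
open Summit.BirchSwinnertonDyer.BirchSwinnertonDyer.Theorems.EtaThetaFunctionalEquation (exists_weierstrass_of_ne_zero
  natCast_pow_mul_mem_span_singleton_iff)

namespace Summit.BirchSwinnertonDyer.BirchSwinnertonDyer.Theorems.EtaLambdaTransfer

/-! ## §131 The Greenberg–Vatsal squeeze in `Λ` -/

section Algebra

variable {p : ℕ} [hp : Fact p.Prime]

/-- `λ(h) = 0` and `μ(h) = n` force `h = C(pⁿ)·unit`. [cite: Washington1997, §7.1 (Thm. 7.3)] -/
theorem eq_C_pow_mul_unit_of_lam_eq_zero {h : IwasawaAlgebra p} (hh : h ≠ 0) (hlam : lam h = 0) :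
    ∃ U : IwasawaAlgebra p, IsUnit U ∧ h = PowerSeries.C ((p : ℤ_[p]) ^ mu h) * U := by
  obtain ⟨P, U, hP, hU, hdeg, hW⟩ := exists_weierstrass_of_ne_zero hh
  rw [hlam] at hdeg
  have hP1 : P = 1 := Polynomial.eq_one_of_monic_natDegree_zero hP.monic hdeg
  refine ⟨U, hU, ?_⟩
  conv_lhs => rw [hW]
  rw [hP1, Polynomial.coe_one, mul_one]

/-- **THE SQUEEZE.** In `Λ = ℤ_p⟦T⟧`: if `g ∣ C(pⁿ)·L` with `L ≠ 0`, `μ(g) = μ(L) = 0` and `λ(g) = λ(L)`, then `(g) = (L)` — Greenberg–Vatsal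
p. 4 ("the equality `λ_alg = λ_an` implies that `f_alg` and `f_an` differ by multiplication by a power of `p`. The further equality
`μ_alg = μ_an` then implies the Main [Conjecture]") with Kato's/Kobayashi's divisibility carrying the slack `pⁿ`.
[cite: GreenbergVatsal2000, p. 4 (after Thm. (1.2))] [cite: Washington1997, §7.1] -/
theorem span_eq_of_dvd_C_pow_mul_of_mu_eq_zero_of_lam_eq {g L : IwasawaAlgebra p} (hL : L ≠ 0) {n : ℕ}
    (hdvd : g ∣ PowerSeries.C ((p : ℤ_[p]) ^ n) * L) (hμg : mu g = 0) (hμL : mu L = 0) (hlam : lam g = lam L) :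
    Ideal.span ({g} : Set (IwasawaAlgebra p)) = Ideal.span {L} := by
  obtain ⟨h, hh⟩ := hdvd
  have hpL : PowerSeries.C ((p : ℤ_[p]) ^ n) * L ≠ 0 := mul_ne_zero (C_pow_ne_zero n) hL
  have hg0 : g ≠ 0 := by rintro rfl; exact hpL (by rw [hh, zero_mul])
  have hh0 : h ≠ 0 := by rintro rfl; exact hpL (by rw [hh, mul_zero])
  -- `μ` and `λ` of `C(pⁿ)·L = g·h`
  have hμ : n = mu h := by
    have h1 : mu (PowerSeries.C ((p : ℤ_[p]) ^ n) * L) = n + mu L := by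
      have hredL : red L ≠ 0 := by
        intro h0
        rw [red_eq_zero_iff] at h0
        exact (hasUnitContent_iff_not_C_dvd L).mp (hasUnitContent_of_mu_eq_zero hL hμL) h0
      exact (mu_eq_and_pfree_eq hredL rfl).1.trans (by rw [hμL, add_zero])
    rw [hh, mu_mul hg0 hh0, hμg, zero_add, hμL, add_zero] at h1
    exact h1.symm
  have hlamh : lam h = 0 := by
    have h1 : lam (PowerSeries.C ((p : ℤ_[p]) ^ n) * L) = lam L := lam_C_pow_mul n hL
    rw [hh, lam_mul hg0 hh0, hlam] at h1
    omega
  obtain ⟨U, hU, hhU⟩ := eq_C_pow_mul_unit_of_lam_eq_zero hh0 hlamh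
  rw [← hμ] at hhU
  -- cancel `C(pⁿ)`: `L = g·U`
  have hLg : L = g * U := by
    apply mul_left_cancel₀ (C_pow_ne_zero (p := p) n)
    rw [hh, hhU]; ring
  rw [hLg]
  exact Ideal.span_singleton_eq_span_singleton.mpr (associated_mul_unit_right g U hU)

/-- For `g` with `μ(g) = 0`, the tree's `λ` IS the order of `g mod p` (the reading used by the analytic fact
`CorpuzLei2025.thm53_…`: `λ_an` = "determined by the image modulo `p`"). [cite: GreenbergVatsal2000, p. 2–3 (1)–(2)] -/
theorem lam_eq_order_map_residue_of_mu_eq_zero {g : IwasawaAlgebra p} (hg : g ≠ 0) (hμ : mu g = 0) :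
    lam g = (PowerSeries.order (PowerSeries.map (IsLocalRing.residue ℤ_[p]) g)).toNat := by
  have hred : red g ≠ 0 := by
    intro h0
    rw [red_eq_zero_iff] at h0
    exact (hasUnitContent_iff_not_C_dvd g).mp (hasUnitContent_of_mu_eq_zero hg hμ) h0
  have hdec : g = PowerSeries.C ((p : ℤ_[p]) ^ 0) * g := by rw [pow_zero, map_one, one_mul]
  obtain ⟨-, hpf⟩ := mu_eq_and_pfree_eq hred hdec
  unfold lam
  rw [hpf]

end Algebra

/-! ## §132 The transfer at a datum -/

section Pair

variable {p : ℕ} [hp : Fact p.Prime]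

/-- **(C1⁺_η) AT A DATUM BY `λ`-TRANSFER.** `p ≥ 5`; `V` (the row) and `V″` (the anchor) globally minimal, both good at `p` with
`a_p = 0`, `V″[p] ≃ V[p]` `Γ_ℚ`-equivariantly (the body of `ModPCongruent V″ V p`); globally minimal `η`-twists `W`, `W″`
(`C • W.quadraticTwist p* = V`, `C″ • W″.quadraticTwist p* = V″`); a finite set `S₀` of finite places `∌ (p)` away from which both
curves are good; Kobayashi's frame `(K₀ = ℚ(μ_p), ηq ≠ 1, κ, γ)`; GRANTED (hypothesis position) Hatley–Lei Thm. 4.6 + Prop. 5.1 (`h46`),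
Kobayashi Thm. 2.2η (`h22`), Thm. 4.1η (`h41`); DISPLAYED: every anchor datum in this frame has `(μ, λ) = (0, λ″)` (`hA`), the newform `f`
of `V`, its period ratio `ϖ`, a branch function `Lη = L_p⁺(V, η, X)` with UNIT CONTENT (`μ_an = 0`) and
**`λ(Lη) + Σ_{w∈S₀} δ(W, w) = λ″ + Σ_{w∈S₀} δ(W″, w)`** (`hLlam` — numerical per row, Corpuz–Lei Thm. 5.3 class-wide). THEN every `η`-datum `D`
of `V` is finitely generated torsion with `Char(D.X) = (Lη)`. Chain: HL19 transports `μ = 0` and the `λ`-identity from an anchor datum;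
`(μ, λ)` of a characteristic generator `g` are those of `D.X`; so `μ(g) = 0 = μ(Lη)`, `λ(g) = λ(Lη)`; Thm. 4.1η: `g ∣ pⁿLη`; §131.
CONDITIONAL; certifies no row by itself. [cite: HatleyLei2019, Thm. 4.6, Prop. 5.1, Cor. 5.2] [cite: Kobayashi2003, Thm. 2.2 (p. 5), Thm. 4.1 (p. 8)]
[cite: GreenbergVatsal2000, p. 4] [cite: Serre1972, §1.11 Prop. 12] -/
theorem etaCharIdeal_eq_span_of_lambdaTransfer
    (h46 : HatleyLei2019.thm46_prop51_etaSignedMuLambda_transfer_of_torsionIso)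
    (h22 : Kobayashi2003.thm22_etaSignedSelmerDual_finite_torsion)
    (h41 : Kobayashi2003.thm41_plusEtaCharIdeal_dvd)
    {V V'' : WeierstrassCurve ℚ} [V.IsElliptic] [V.IsGloballyMinimal] [V''.IsElliptic] [V''.IsGloballyMinimal]
    (hp5 : 5 ≤ p) (hgood : V.HasGoodReductionAtPrime p) (hap : V.frobeniusTrace p = 0)
    (hgood'' : V''.HasGoodReductionAtPrime p) (hap'' : V''.frobeniusTrace p = 0)
    (hcong : ∃ e : geomTorsion V'' (p : ℤ) ≃+ geomTorsion V (p : ℤ),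
      ∀ (σ : absoluteGaloisGroup ℚ) (P : geomTorsion V'' (p : ℤ)), e (σ • P) = σ • e P)
    (W W'' : WeierstrassCurve ℚ) [W.IsElliptic] [W.IsGloballyMinimal] [W''.IsElliptic] [W''.IsGloballyMinimal]
    (C C'' : VariableChange ℚ) (hCV : C • W.quadraticTwist ((-1) ^ (p / 2) * p) = V)
    (hCV'' : C'' • W''.quadraticTwist ((-1) ^ (p / 2) * p) = V'')
    (S₀ : Finset (HeightOneSpectrum (𝓞 ℚ))) (hS₀ : ∀ w ∈ S₀, ((p : ℕ) : 𝓞 ℚ) ∉ w.asIdeal)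
    (hS : ∀ w : HeightOneSpectrum (𝓞 ℚ), w ∉ S₀ → ((p : ℕ) : 𝓞 ℚ) ∉ w.asIdeal → V.HasGoodReductionAt w)
    (hS'' : ∀ w : HeightOneSpectrum (𝓞 ℚ), w ∉ S₀ → ((p : ℕ) : 𝓞 ℚ) ∉ w.asIdeal → V''.HasGoodReductionAt w)
    (K₀ : Type) [Field K₀] [NumberField K₀] [IsCyclotomicExtension {p} ℚ K₀]
    [(galRange (K := ℚ) K₀).Normal] (ηq : absoluteGaloisGroup ℚ →* ℤˣ)
    (hηK : ∀ σ ∈ galRange (K := ℚ) K₀, ηq σ = 1) (hη1 : ηq ≠ 1)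
    (κ : ZpExtension ℚ p) (γ : absoluteGaloisGroup ℚ) (hκ : κ.IsCyclotomic) (hγ : κ.IsTopGenerator γ)
    (hγK : γ ∈ galRange (K := ℚ) K₀) (hγc : IsCyclotomicVariable p γ)
    {lamA : ℕ}
    (hA : ∀ D'' : EtaSignedSelmerDualData V'' κ K₀ ℚ_[p] ηq γ 1,
      muInvariant p D''.X = 0 ∧ lambdaInvariant p D''.X = lamA)
    {N : ℕ} [NeZero N] {f : CuspForm (Gamma0 N) 2} (hf : IsNewformOf V f) (ϖ : ℚ)
    (hϖ : if Even (p / 2) then (ϖ : ℝ) * V.realPeriodRat = plusPeriod f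
      else (ϖ : ℝ) * V.imaginaryPeriodRat = minusPeriod f)
    (Lη : IwasawaAlgebra p) (hL : IsQuadraticBranchPlusLFunction f p ϖ Lη)
    (hLμ : HasUnitContent Lη) (hLlam : lam Lη + ∑ w ∈ S₀, delta W p w = lamA + ∑ w ∈ S₀, delta W'' p w)
    (D : EtaSignedSelmerDualData V κ K₀ ℚ_[p] ηq γ 1) :
    Module.Finite (IwasawaAlgebra p) D.X ∧ Module.IsTorsion (IwasawaAlgebra p) D.X ∧ D.charIdeal = Ideal.span {Lη} := by
  have hp2 : p ≠ 2 := by omega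
  obtain ⟨hfin, htor⟩ := EtaSignedSelmerDualData.finite_isTorsion_of_thm22 h22 hηK hp2 hgood hap hκ hγ hγK D
  haveI : Module.Finite (IwasawaAlgebra p) D.X := hfin
  refine ⟨hfin, htor, ?_⟩
  -- an anchor datum (exists) and its displayed invariants
  obtain ⟨DA⟩ := nonempty_etaSignedSelmerDualData_cyclotomic V'' κ K₀ ℚ_[p] ηq 1 hγ hγK
  obtain ⟨hμA, hlamA⟩ := hA DA
  obtain ⟨hfinA, htorA⟩ := EtaSignedSelmerDualData.finite_isTorsion_of_thm22 h22 hηK hp2 hgood'' hap'' hκ hγ hγK DA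
  have hμA' : DA.toLiterature.mu = 0 := hμA
  have hlamA' : DA.toLiterature.lambda = lamA := hlamA
  -- (irred) for both curves (Serre, Prop. 12)
  have hirr : V.HasIrreducibleModPGaloisRep p :=
    hasIrreducibleModPGaloisRep_of_dvd_frobeniusTrace V p hp2
      (not_dvd_minimalDiscriminantInt_of_hasGoodReductionAtPrime' V p hgood) (hap ▸ dvd_zero _)
  have hirr'' : V''.HasIrreducibleModPGaloisRep p :=
    hasIrreducibleModPGaloisRep_of_dvd_frobeniusTrace V'' p hp2
      (not_dvd_minimalDiscriminantInt_of_hasGoodReductionAtPrime' V'' p hgood'') (hap'' ▸ dvd_zero _)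
  -- Hatley–Lei: transport from the anchor datum to `D`
  obtain ⟨hμD, hlamD⟩ := h46 V'' V p hp2 hgood'' hap'' hgood hap hirr'' hirr hcong W'' W C'' C hCV'' hCV S₀ hS₀ hS'' hS K₀ ηq hηK
    hη1 κ γ hκ hγ hγK 1 DA.toLiterature D.toLiterature hfinA htorA hfin htor hμA'
  rw [hlamA'] at hlamD
  -- `hlamD : lamA + Σ δ(W'') = λ(D.X) + Σ δ(W)`; `hμD : μ(D.X) = 0`
  have hμD' : muInvariant p D.X = 0 := hμD
  have hlamD' : lamA + ∑ w ∈ S₀, delta W'' p w = lambdaInvariant p D.X + ∑ w ∈ S₀, delta W p w := hlamD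
  -- a generator `g` of `Char(D.X)` and Kobayashi's Thm. 4.1 at `η`: `g ∣ pⁿ·Lη`
  obtain ⟨g, hg⟩ := (charIdeal_isPrincipal_holds p D.X).principal
  have hg' : D.charIdeal = Ideal.span {g} := hg
  obtain ⟨⟨n, hn⟩, -⟩ := h41 p K₀ ηq hηK hη1 V hp2 hgood hap hf ϖ hϖ Lη hL κ γ hκ hγ hγK hγc D.toLiterature hfin htor
  rw [EtaSignedSelmerDualData.charIdeal_toLiterature, hg', natCast_pow_mul_mem_span_singleton_iff] at hn
  have hL0 : Lη ≠ 0 := by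
    rintro rfl
    obtain ⟨k, hk⟩ := hLμ
    simp at hk
  have hg0 : g ≠ 0 := by
    rintro rfl
    obtain ⟨q, hq⟩ := hn
    exact mul_ne_zero (C_pow_ne_zero n) hL0 (by rw [hq, zero_mul])
  -- invariants of `g` are those of `D.X`
  have hμg : mu g = 0 := (mu_generator_eq_muInvariant D.X htor hg0 hg').trans hμD'
  have hlamg : lam g = lambdaInvariant p D.X := lam_generator_eq_lambdaInvariant D.X htor hg0 hg'
  have hlamgA : lam g + ∑ w ∈ S₀, delta W p w = lamA + ∑ w ∈ S₀, delta W'' p w := by rw [hlamg]; exact hlamD'.symm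
  have hμL : mu Lη = 0 := mu_eq_zero_of_hasUnitContent hLμ
  have hlam : lam g = lam Lη := Nat.add_right_cancel (hlamgA.trans hLlam.symm)
  rw [hg']
  exact span_eq_of_dvd_C_pow_mul_of_mu_eq_zero_of_lam_eq hL0 hn hμg hμL hlam

/-! ## §133 The node at a row -/

/-- **(C1⁺_η)(V) BY `λ`-TRANSFER — the node `QuadraticBranchPlusEtaMainConjectureAt V p` at a row.** Inputs as in §132, with the
anchor's invariants displayed in EVERY frame (`hA`: one number `λ″` — the `λ` of `X⁺(V″/K_∞)^η` does not depend on the frame), the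
analytic side of `V` displayed for EVERY `(f, ϖ, Lη)` (`han`: unit content and `λ(Lη) = λ_V` — the census digit), and ONE numerical
identity `λ_V + Σ δ(W) = λ″ + Σ δ(W″)` (`hnum`). GRANTED `h46 h22 h41`. CONDITIONAL; the per-row instances (kit certificates) are
separate record files. [cite: HatleyLei2019, Thm. 4.6, Prop. 5.1, Cor. 5.2] [cite: Kobayashi2003, §4 Even main conjecture, Thm. 4.1 (p. 8)]
[cite: GreenbergVatsal2000, p. 4] -/
theorem quadraticBranchPlusEtaMainConjectureAt_of_lambdaTransfer
    (h46 : HatleyLei2019.thm46_prop51_etaSignedMuLambda_transfer_of_torsionIso)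
    (h22 : Kobayashi2003.thm22_etaSignedSelmerDual_finite_torsion)
    (h41 : Kobayashi2003.thm41_plusEtaCharIdeal_dvd)
    {V V'' : WeierstrassCurve ℚ} [V.IsElliptic] [V.IsGloballyMinimal] [V''.IsElliptic] [V''.IsGloballyMinimal]
    (hp5 : 5 ≤ p) (hgood : V.HasGoodReductionAtPrime p) (hap : V.frobeniusTrace p = 0)
    (hgood'' : V''.HasGoodReductionAtPrime p) (hap'' : V''.frobeniusTrace p = 0)
    (hcong : ∃ e : geomTorsion V'' (p : ℤ) ≃+ geomTorsion V (p : ℤ),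
      ∀ (σ : absoluteGaloisGroup ℚ) (P : geomTorsion V'' (p : ℤ)), e (σ • P) = σ • e P)
    (W W'' : WeierstrassCurve ℚ) [W.IsElliptic] [W.IsGloballyMinimal] [W''.IsElliptic] [W''.IsGloballyMinimal]
    (C C'' : VariableChange ℚ) (hCV : C • W.quadraticTwist ((-1) ^ (p / 2) * p) = V)
    (hCV'' : C'' • W''.quadraticTwist ((-1) ^ (p / 2) * p) = V'')
    (S₀ : Finset (HeightOneSpectrum (𝓞 ℚ))) (hS₀ : ∀ w ∈ S₀, ((p : ℕ) : 𝓞 ℚ) ∉ w.asIdeal)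
    (hS : ∀ w : HeightOneSpectrum (𝓞 ℚ), w ∉ S₀ → ((p : ℕ) : 𝓞 ℚ) ∉ w.asIdeal → V.HasGoodReductionAt w)
    (hS'' : ∀ w : HeightOneSpectrum (𝓞 ℚ), w ∉ S₀ → ((p : ℕ) : 𝓞 ℚ) ∉ w.asIdeal → V''.HasGoodReductionAt w)
    {lamA lamV : ℕ}
    (hA : ∀ (K₀ : Type) [Field K₀] [NumberField K₀] [IsCyclotomicExtension {p} ℚ K₀]
        [(galRange (K := ℚ) K₀).Normal] (ηq : absoluteGaloisGroup ℚ →* ℤˣ),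
        (∀ σ ∈ galRange (K := ℚ) K₀, ηq σ = 1) → ηq ≠ 1 →
      ∀ (κ : ZpExtension ℚ p) (γ : absoluteGaloisGroup ℚ),
        κ.IsCyclotomic → κ.IsTopGenerator γ → γ ∈ galRange (K := ℚ) K₀ →
      ∀ D'' : EtaSignedSelmerDualData V'' κ K₀ ℚ_[p] ηq γ 1, muInvariant p D''.X = 0 ∧ lambdaInvariant p D''.X = lamA)
    (han : ∀ {N : ℕ} [NeZero N] {f : CuspForm (Gamma0 N) 2}, IsNewformOf V f →
      ∀ (ϖ : ℚ), (if Even (p / 2) then (ϖ : ℝ) * V.realPeriodRat = plusPeriod f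
          else (ϖ : ℝ) * V.imaginaryPeriodRat = minusPeriod f) →
      ∀ (Lη : IwasawaAlgebra p), IsQuadraticBranchPlusLFunction f p ϖ Lη → HasUnitContent Lη ∧ lam Lη = lamV)
    (hnum : lamV + ∑ w ∈ S₀, delta W p w = lamA + ∑ w ∈ S₀, delta W'' p w) :
    QuadraticBranchPlusEtaMainConjectureAt V p := by
  intro K₀ _ _ _ _ ηq hηK hη1 N _ f hp2 hgoodV hapV hf ϖ hϖ Lη hL κ γ hκ hγ hγK hγc D
  obtain ⟨hLμ, hLlam⟩ := han hf ϖ hϖ Lη hL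
  exact etaCharIdeal_eq_span_of_lambdaTransfer h46 h22 h41 hp5 hgood hap hgood'' hap'' hcong W W'' C C'' hCV hCV'' S₀ hS₀ hS
    hS'' K₀ ηq hηK hη1 κ γ hκ hγ hγK hγc (hA K₀ ηq hηK hη1 κ γ hκ hγ hγK) hf ϖ hϖ Lη hL hLμ (by rw [hLlam]; exact hnum) D

/-! ## §134 The anchor's displayed invariants from (C1⁺_η) at the anchor -/

/-- **The anchor's `(μ, λ)_alg` from (C1⁺_η)(V″) and `μ_an(V″) = 0`.** If Kobayashi's even main conjecture at `η` holds for `(V″, p)`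
(the node; e.g. k8eta-c2 g7's CM theorem `EtaFineRoad.etaMC_cm…` or a by-name record) and a branch function `Lη″ = L_p⁺(V″, η, X)` (newform
`f″`, period ratio `ϖ″`) has unit content, then in every frame every `η`-datum `D″` of `V″` has `μ = 0` and `λ = λ(Lη″)` — the input `hA`
of §132/§133 with `λ″ = λ(Lη″)`. Bookkeeping (`Char = (Lη″)` ⟹ `μ`, `λ` of the generator). [cite: Kobayashi2003, §4 Even main conjecture (p. 8)]
[cite: GreenbergVatsal2000, p. 2 (1)–(2)] -/
theorem anchor_mu_lambda_of_plusEtaMainConjectureAt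
    {V'' : WeierstrassCurve ℚ} [V''.IsElliptic] [V''.IsGloballyMinimal]
    (hp2 : p ≠ 2) (hgood'' : V''.HasGoodReductionAtPrime p) (hap'' : V''.frobeniusTrace p = 0)
    (hMC : QuadraticBranchPlusEtaMainConjectureAt V'' p)
    {N'' : ℕ} [NeZero N''] {f'' : CuspForm (Gamma0 N'') 2} (hf'' : IsNewformOf V'' f'') (ϖ'' : ℚ)
    (hϖ'' : if Even (p / 2) then (ϖ'' : ℝ) * V''.realPeriodRat = plusPeriod f''
      else (ϖ'' : ℝ) * V''.imaginaryPeriodRat = minusPeriod f'')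
    (Lη'' : IwasawaAlgebra p) (hL'' : IsQuadraticBranchPlusLFunction f'' p ϖ'' Lη'') (hμ'' : HasUnitContent Lη'')
    (K₀ : Type) [Field K₀] [NumberField K₀] [IsCyclotomicExtension {p} ℚ K₀]
    [(galRange (K := ℚ) K₀).Normal] (ηq : absoluteGaloisGroup ℚ →* ℤˣ)
    (hηK : ∀ σ ∈ galRange (K := ℚ) K₀, ηq σ = 1) (hη1 : ηq ≠ 1)
    (κ : ZpExtension ℚ p) (γ : absoluteGaloisGroup ℚ) (hκ : κ.IsCyclotomic) (hγ : κ.IsTopGenerator γ)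
    (hγK : γ ∈ galRange (K := ℚ) K₀) (hγc : IsCyclotomicVariable p γ)
    (D'' : EtaSignedSelmerDualData V'' κ K₀ ℚ_[p] ηq γ 1) :
    muInvariant p D''.X = 0 ∧ lambdaInvariant p D''.X = lam Lη'' := by
  obtain ⟨hfin, htor, hchar⟩ := hMC K₀ ηq hηK hη1 hp2 hgood'' hap'' hf'' ϖ'' hϖ'' Lη'' hL'' κ γ hκ hγ hγK hγc D''
  have hL0 : Lη'' ≠ 0 := by
    rintro rfl
    obtain ⟨k, hk⟩ := hμ''
    simp at hk
  haveI : Module.Finite (IwasawaAlgebra p) D''.X := hfin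
  have hchar' : Literature.NumberTheory.EllipticCurves.Module.charIdeal (IwasawaAlgebra p) D''.X = Ideal.span {Lη''} := hchar
  refine ⟨?_, ?_⟩
  · rw [← mu_generator_eq_muInvariant D''.X htor hL0 hchar']
    exact mu_eq_zero_of_hasUnitContent hμ''
  · exact (lam_generator_eq_lambdaInvariant D''.X htor hL0 hchar').symm

end Pair

end Summit.BirchSwinnertonDyer.BirchSwinnertonDyer.Theorems.EtaLambdaTransfer

end
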